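import Summits.BirchSwinnertonDyer.BirchSwinnertonDyer.Theorems.PrintX9MuPartStubAHowardInputsOfClauses
import Summits.BirchSwinnertonDyer.BirchSwinnertonDyer.Theorems.PrintX10bControlGlueOfClauses
import Summits.BirchSwinnertonDyer.BirchSwinnertonDyer.Theorems.PrintX9MuPartStabilizedCoherentPairOfCyclic
import Summits.BirchSwinnertonDyer.BirchSwinnertonDyer.Theses.PrintX9
import HarnessLib

/-!
# The shared deciding μ-crux `MuInequalityCoherentPairOfPrintCG` (stmt-BirchSwinnertonDyer-23428) FROM ITS FOUR REGISTERED STUBS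
# — the reduction certificate of skeleton v8 of line `spec_witnesses`, in the tree (helper; the crux itself is NOT closed here)

Summits-side helper (μ-LEAD `bsd-line-x9-p1` g4; `--supports` stmt-BirchSwinnertonDyer-23428).  One letter (`Stmt.portCyclic`, the v2
cyclic port statement, verbatim from the skeleton) + theorems; no named fact, no instance, no `sorry`.

* `portCyclic_of h161 hK hCG hA hB` — the cyclic port statement `HasSpecWitnesses` on every μ-frame from Howard Thm. 1.6.1 (`h161`),
  CGLS Thm. 4.1.1 (`hK`), Greenberg Prop. 2.4 (`hCG`) BY NAME and the two stub letters `hA : HeegnerMuPartStubA.Stmt.howardInputs`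
  (p673958) / `hB : HeegnerMuPartControlGlue.Stmt.controlGlue` (p670216): STUB A at `m` gives the Eisenstein data, `SatisfiesH`,
  `LargePrimes` and the Kolyvagin system with bottom class the control image of `z` (non-zero — whence `z ≠ 0`, extracted at
  `m := max m₀ 1`); `h161` gives Howard's `Conclusion` at that class; STUB B turns it into a `SpecWitness` with the uniform `c`.
* `muPartStabilizedCoherentPair_of_thm161_thm411_cg`, `muInequalityCoherentPairOfPrintCG_of_stubLetters` — the L∃ letter / the
  crux BY NAME (`Theses.PrintX9.MuInequalityCoherentPairOfPrintCG`) from `hA`, `hB` (engine p644084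
  `HeegnerMuPartStabilized.muPartStabilizedCoherentPair_of_forall_cyclic`).
* **`muInequalityCoherentPairOfPrintCG_of_stubs (HE) (H5P) (hB4) (hB5)`** — the crux BY NAME from EXACTLY the four registered stubs of
  skeleton v8: `Stmt.exactAtP` ((Exact) at `v ∣ p`), `Stmt.h5bAtSZeroP` (H.5(b) level `0` at `v ∣ p`), `Stmt.readoutSelmer` ((B4)),
  `Stmt.readoutIndex` ((B5)).
HONEST FRAMING: a CONDITIONAL reduction — the four stub letters are hypotheses; the item stays OPEN until they land; no summit
statement is proved; BSD is not proved by any of this.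

References: [Howard2004HeegnerKolyvagin] Thm. 1.6.1, Prop. 2.2.8, proof of Thm. 2.2.10; [CastellaGrossiLeeSkinner2022] Thm. 4.1.1,
Rem. 4.1.4; [GreenbergLNM1716] Prop. 2.4; [MastellaZerman2026] Thm. 2.40.
-/

set_option linter.dupNamespace false
set_option autoImplicit false

noncomputable section

open scoped Classical Pointwise ContRepresentation TensorProduct NumberField

open Function NumberField IsDedekindDomain Field
open Literature Literature.NumberTheory.EllipticCurves WeierstrassCurve
open Literature.NumberTheory.GaloisCohomology Literature.NumberTheory.GaloisCohomology.Howard2004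
open Literature.NumberTheory.Automorphic
open Literature.NumberTheory.GaloisRepresentations Literature.NumberTheory.GaloisRepresentations.DiscreteGaloisModule
open Summit.BirchSwinnertonDyer.BirchSwinnertonDyer.Theorems

namespace Summit.BirchSwinnertonDyer.BirchSwinnertonDyer.Theorems.HeegnerMuPartOfPrintCG

set_option synthInstance.maxHeartbeats 80000 in
/-- **The cyclic port statement** (skeleton letter `Stmt.portCyclic`, verbatim): `HasSpecWitnesses` on every μ-frame. -/
abbrev Stmt.portCyclic : Prop :=
  ∀ (N : ℕ) [NeZero N] (W : WeierstrassCurve ℚ) [W.IsGloballyMinimal] (K : Type) [Field K] [NumberField K]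
    (p : ℕ) [Fact p.Prime] (κ : ZpExtension K p) (γ : Field.absoluteGaloisGroup K)
    (jbar : AlgebraicClosure K →+* ℂ),
    CastellaGrossiLeeSkinner2022.Thm413Hypotheses N W K p κ γ →
    ¬ W.HasCM → W.HasIrreducibleModPGaloisRep p → (W.baseChange K).HasIrreducibleModPGaloisRep p →
    MastellaZerman2026.HasPadicScalarImage W p → SatisfiesHeegnerHypothesis p K →
    p ∣ NumberField.classNumber K →
    ∀ (D : (W.baseChange K).LambdaAdicSelmerData κ γ)
      (C : CastellaGrossiLeeSkinner2022.StabilizedHeegnerData N W K κ jbar)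
      (X : (W.baseChange K).SelmerDualData κ γ) (z : D.S),
    (∀ (k : ℕ) (hk : C.depth < k), D.proj k z ∈ CastellaGrossiLeeSkinner2022.stabilizedClassLayer C k hk) →
    CastellaGrossiLeeSkinner2022.stabilizedHeegnerModule D C = Submodule.span (IwasawaAlgebra p) {z} →
    Module.Finite (IwasawaAlgebra p) D.S → Module.Finite (IwasawaAlgebra p) X.X →
    Module.IsTorsion (IwasawaAlgebra p) (D.S ⧸ CastellaGrossiLeeSkinner2022.stabilizedHeegnerModule D C) →
    HeegnerMuPartStabilized.HasSpecWitnesses p D.S X.X (CastellaGrossiLeeSkinner2022.stabilizedHeegnerModule D C)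


set_option synthInstance.maxHeartbeats 80000 in
/-- **The cyclic port statement from the stubs, GIVEN Howard's Thm. 1.6.1, CGLS's Thm. 4.1.1 and Greenberg's Prop. 2.4** (the
binders of the round-3 crux text). -/
theorem portCyclic_of (h161 : Literature.NumberTheory.GaloisCohomology.Howard2004.thm161_dvrKolyvaginBound)
    (hK : Literature.NumberTheory.EllipticCurves.CastellaGrossiLeeSkinner2022.thm411_exists_kolyvaginSystem_one_ne_zero)
    (hCG : Literature.NumberTheory.EllipticCurves.Greenberg1999.imKummer_eq_strictCondition_goodOrdinary_numberField)
    (hA : HeegnerMuPartStubA.Stmt.howardInputs) (hB : HeegnerMuPartControlGlue.Stmt.controlGlue) :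
    Stmt.portCyclic := by
  intro N _ W _ K _ _ p _ κ γ jbar hyp hCM hirr hirrK hsc hHp hhK D C X z hz hcyc hfinS hfinX htor
  obtain ⟨m₀, hA⟩ := hA hK N W K p κ γ jbar hyp hCM hirr hirrK hsc hHp hhK D C X z hz hcyc hfinS hfinX htor
  -- `z ≠ 0` from STUB A at the level `max m₀ 1`: the Kolyvagin system's bottom class is `ctrlLevel … z`, non-zero
  have hz0 : z ≠ 0 := by
    have hm' : 1 ≤ max m₀ 1 := le_max_right _ _
    haveI := hyp.isElliptic
    letI := IwasawaAlgebra.isDomain_quotient_X_pow_add_C p hm'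
    letI := IwasawaAlgebra.isDiscreteValuationRing_quotient_X_pow_add_C p hm'
    haveI := IwasawaAlgebra.EisensteinCoeff.isLocalRing_succ p hm'
    letI := IwasawaAlgebra.EisensteinCoeff.algebraOfSpecSucc p (max m₀ 1)
    haveI := W.isScalarTower_algebraOfSpecSucc (K := K) (p := p) (m := max m₀ 1)
    letI := W.residueModuleSucc (K := K) (p := p) hm'
    obtain ⟨_S₀, _hpS₀, _hbad₀, _hSN₀, _hSσ₀, _L₀, _hL₀, _hLS₀, _jbar₀, _cd₀, _Dd₀, _fs₀, _t₀, _ht₀, _I₀, _hy₀, κ₀, _hlarge₀,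
      hone₀, hlink₀⟩ := hA (max m₀ 1) hm' (le_max_left _ _)
    intro hz
    subst hz
    exact hone₀ (funext fun k ↦ by
      rw [hlink₀ k, Pi.zero_apply, map_zero, map_zero]
      rfl)
  obtain ⟨c, m₁, hB⟩ :=
    hB hCG N W K p κ γ jbar hyp hCM hirr hirrK hsc hHp hhK D C X z hz hcyc hfinS hfinX htor hz0
  refine ⟨c, max (max m₀ m₁) 1, fun m hm' ↦ ?_⟩
  have hm : 1 ≤ m := le_trans (le_max_right _ _) hm'
  have hm0 : m₀ ≤ m := le_trans ((le_max_left _ _).trans (le_max_left _ _)) hm'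
  have hm1 : m₁ ≤ m := le_trans ((le_max_right _ _).trans (le_max_left _ _)) hm'
  haveI := hyp.isElliptic
  letI := IwasawaAlgebra.isDomain_quotient_X_pow_add_C p hm
  letI := IwasawaAlgebra.isDiscreteValuationRing_quotient_X_pow_add_C p hm
  haveI := IwasawaAlgebra.EisensteinCoeff.isLocalRing_succ p hm
  letI := IwasawaAlgebra.EisensteinCoeff.algebraOfSpecSucc p m
  haveI := W.isScalarTower_algebraOfSpecSucc (K := K) (p := p) (m := m)
  letI := W.residueModuleSucc (K := K) (p := p) hm
  obtain ⟨S, hpS, hbad, hSN, hSσ, L, hL, hLS, jbar', cd, Dd, fs, t, ht, I, hy, κKS, hlarge, hone, hlink⟩ := hA m hm hm0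
  have hconc := h161 p K _ _ _ _ _ (W.eisensteinDVRSetting (κ.unitTwist (-1)) hm S hpS hbad L hL hLS jbar' cd Dd fs)
    κKS hy hlarge hone
  have hone_eq : κKS.one =
      fun k ↦ I.proj (k + 1) (D.toEisensteinH1Linear hm t ht I hyp.topGenerator hyp.noPTorsion z) :=
    funext hlink
  rw [hone_eq] at hconc
  exact hB m hm hm1 S hpS hbad hSN hSσ L hL hLS jbar' cd Dd fs t ht I hy hconc

/-- **Route-free form**: Howard Thm. 1.6.1 ⟹ CGLS Thm. 4.1.1 ⟹ Greenberg Prop. 2.4 ⟹ the L∃ letter, from the kernel stubs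
(p644084 last). -/
theorem muPartStabilizedCoherentPair_of_thm161_thm411_cg (hA : HeegnerMuPartStubA.Stmt.howardInputs)
    (hB : HeegnerMuPartControlGlue.Stmt.controlGlue) :
    Literature.NumberTheory.GaloisCohomology.Howard2004.thm161_dvrKolyvaginBound →
      Literature.NumberTheory.EllipticCurves.CastellaGrossiLeeSkinner2022.thm411_exists_kolyvaginSystem_one_ne_zero →
        Literature.NumberTheory.EllipticCurves.Greenberg1999.imKummer_eq_strictCondition_goodOrdinary_numberField →
          HeegnerMuPartStabilized.MuPartStabilizedCoherentPair :=
  fun h161 hK hCG ↦ HeegnerMuPartStabilized.muPartStabilizedCoherentPair_of_forall_cyclic (portCyclic_of h161 hK hCG hA hB)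

/-- **The shared deciding μ-crux BY NAME from the two stub letters** (row 9's copy of the round-3 item stmt-BirchSwinnertonDyer-23428;
row 10's twin states the same over `Theses.PrintX10b`): `MuInequalityCoherentPairOfPrintCG := HowardDVRKolyvaginBound →
CGLSHeegnerKolyvaginSystem → CoatesGreenbergKummerImage → MuInequalityCoherentPair`, each leaf `Iff.rfl` to the fact it names. -/
theorem muInequalityCoherentPairOfPrintCG_of_stubLetters (hA : HeegnerMuPartStubA.Stmt.howardInputs)
    (hB : HeegnerMuPartControlGlue.Stmt.controlGlue) :
    Summit.BirchSwinnertonDyer.BirchSwinnertonDyer.Theses.PrintX9.MuInequalityCoherentPairOfPrintCG :=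
  fun h161 hK hCG ↦ muPartStabilizedCoherentPair_of_thm161_thm411_cg hA hB h161 hK hCG

/-- **THE REDUCTION CERTIFICATE of skeleton v8, in the tree**: the shared deciding μ-crux `MuInequalityCoherentPairOfPrintCG`
(stmt-BirchSwinnertonDyer-23428) BY NAME from EXACTLY its four registered stubs — (Exact) at `v ∣ p` (`Stmt.exactAtP`), the
level-`0` clause of H.5(b) at `v ∣ p` (`Stmt.h5bAtSZeroP`), the readout-lands-in-Selmer clause (`Stmt.readoutSelmer`, (B4)) and
the m-uniform index bound (`Stmt.readoutIndex`, (B5)) — everything else (D1's chain, Poitou–Tate, the KS-LINK, the compact and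
discrete control turnkeys, the cyclic port engine) being kernel theorems.  The crux closes the minute the four land. -/
theorem muInequalityCoherentPairOfPrintCG_of_stubs (HE : HeegnerMuPartH4AtS.Stmt.exactAtP)
    (H5P : HeegnerMuPartStubA.Stmt.h5bAtSZeroP) (hB4 : HeegnerMuPartControlGlue.Stmt.readoutSelmer)
    (hB5 : HeegnerMuPartControlGlue.Stmt.readoutIndex) :
    Summit.BirchSwinnertonDyer.BirchSwinnertonDyer.Theses.PrintX9.MuInequalityCoherentPairOfPrintCG :=
  muInequalityCoherentPairOfPrintCG_of_stubLetters (HeegnerMuPartStubA.howardInputs_of_exactAtP_of_clauseZeroP HE H5P)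
    (HeegnerMuPartControlGlue.controlGlue_of_clauses hB4 hB5)


end Summit.BirchSwinnertonDyer.BirchSwinnertonDyer.Theorems.HeegnerMuPartOfPrintCG

end
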